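import Mathlib
import Summits.Ventures.PercRepro2.Defs
import Summits.Ventures.PercRepro2.Independence
import Summits.Ventures.PercRepro2.Graph
import Summits.Ventures.PercRepro2.Exploration
import Summits.Ventures.PercRepro2.Induced
import Summits.Ventures.PercRepro2.R2PrimeThreeReduction
import Summits.Ventures.PercRepro2.YBridge
import Summits.Ventures.PercRepro2.HCov
import Summits.Ventures.PercRepro2.HCovFns
import Summits.Ventures.PercRepro2.HCovCubic
import Summits.Ventures.PercRepro2.HubModel
import Summits.Ventures.PercRepro2.HubLaw
import Summits.Ventures.PercRepro2.HubRootLaw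
import Summits.Ventures.PercRepro2.HubConn
import Summits.Ventures.PercRepro2.HubBernstein
import Summits.Ventures.PercRepro2.HubGc
import Summits.Ventures.PercRepro2.HubKron
import Summits.Ventures.PercRepro2.HubCert
import Summits.Ventures.PercRepro2.HubCertPart1
import Summits.Ventures.PercRepro2.HubCertPart2
import Summits.Ventures.PercRepro2.HubCertPart3
import Summits.Ventures.PercRepro2.HubCertPart4
import Summits.Ventures.PercRepro2.HubCertPart5
import Summits.Ventures.PercRepro2.HubCertPart6
import Summits.Ventures.PercRepro2.HubCertAll
import Summits.Ventures.PercRepro2.HubKernelP1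

/-!
# The symmetrised Kronecker hub number of p1's kernel `K₃`
(blind cell PercRepro2, typer-1 g8; the typed R theorem, part T2)

`kronSymK3 a b d` is the sum of the six `kronWK3` over the orderings of the atom triple; the
kernel checks `HubKernelP1Chunk0.lean` … compare its double with the certificate number `certNum`
of `HubCertAll.lean` — the same certificates as for the weighted kernel (the two kernels have
the same cubic form, hence the same symmetrised hub table).
-/

namespace Summit.Ventures.PercRepro2.Hub

/-- The symmetrised Kronecker hub number of `K₃` at an atom triple. -/
def kronSymK3 (a b d : Fin 5) : ℤ :=
  kronWK3 (atomPat a) (atomPat b) (atomPat d) + kronWK3 (atomPat a) (atomPat d) (atomPat b) +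
    kronWK3 (atomPat b) (atomPat a) (atomPat d) + kronWK3 (atomPat b) (atomPat d) (atomPat a) +
    kronWK3 (atomPat d) (atomPat a) (atomPat b) + kronWK3 (atomPat d) (atomPat b) (atomPat a)

/-- The hub table of `K₃` on the atoms. -/
def W5K3 (k : Fin 7 → Fin 4) : Fin 5 → Fin 5 → Fin 5 → ℤ := fun a b d =>
  WtotK3 k (atomPat a) (atomPat b) (atomPat d)

set_option maxRecDepth 8000 in
/-- The symmetrised hub number of `K₃` is the Kronecker number of the symmetrised table. -/
lemma kronSymK3_eq (a b d : Fin 5) : kronSymK3 a b d = ∑ k, sym3 (W5K3 k) a b d * KB ^ idx4K k := by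
  unfold kronSymK3
  simp only [kronWK3_eq, ← Finset.sum_add_distrib]
  refine Finset.sum_congr rfl fun k _ => ?_
  unfold sym3 W5K3
  ring

end Summit.Ventures.PercRepro2.Hub
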